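/-
Copyright (c) 2026. All rights reserved.
Released under Apache 2.0 license as described in the file LICENSE.
Authors: abc-iut cell, seat abc-iut-f-069 (gen 3; one-name bundle of the constructed-model column of [AbsTopII] Prop 1.3).
-/
import Literature.AnabelianGeometry.AbsoluteAnabelian.AbsTopII.DPSCDataOfOuterActionInputL
import Literature.AnabelianGeometry.AbsoluteAnabelian.AbsTopII.DPSCIndexDataOfEmbeddingCuspScope
import Literature.AnabelianGeometry.AbsoluteAnabelian.AbsTopII.DPSCIndexDataOfEmbeddingCuspCyclic

/-!
# [AbsTopII] Prop 1.3 at the DPSC-extension of construction data: ONE bundle from construction-data hypotheses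

S. Mochizuki, *Topics in Absolute Anabelian Geometry II* [AbsTopII] (bib `MochizukiAbsTopII2013`; kurims
manuscript `paper:url-585b8d0ad0d9`), §1 Def 1.2 (ii) p. 10, Prop 1.3 (i)–(ix) pp. 11–12; [CombGC] (bib
`MochizukiCombGC2007`) Def 1.1 (ii), Rmk 1.1.3, Prop 1.2 (i)(ii), Def 1.4 (i); [CbTpII] Def 4.4 (profinite
Dehn multi-twists).

PROOF-ONLY (no definition): ONE NAME for the constructed-model column of the cell's sub-DAG
`plan/L4/SUBDAG-AbsTopII-Prop13.md` — at the DPSC-extension `Π_H := Π_𝒢 ⋊^out_θ J` of PSC construction data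
(abc-iut-w5-d226's `DPSCData.ofOuterAction`, enriched with `Σ`-indices: abc-iut-f-069's
`DPSCIndexData.ofOuterAction`), the typed [AbsTopII] Prop 1.3 clauses
**(i) F-0297, (iii) F-0275, (iii)′ F-0299, (iii)″ (Π_𝔾-scope), (v) F-0278, (v)′ F-0300, (vi) F-0279,
(vii) F-0280, (ix) F-0277** hold TOGETHER from hypotheses on the CONSTRUCTION DATA `(G, J, θ, I)` only:
* on the PSC datum `G` (layer L3): [CombGC] Prop 1.2 (ii) (F-0438) and (i) (F-0459), slim verticial
  subgroups and free pro-`Σ`-cyclic cuspidal / abelian nodal subgroups (Rmk 1.1.3), `Π_𝒢` slim non-trivial;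
* on the outer action `θ : J → Out(Π_𝒢)`: graphic lifts (Def 1.2 (ii) "`Aut(𝒢) ⊆ Out(Π_𝒢)`");
* on the inertia `I ⊴ J`: `I` closed with `I ≅ Ẑ^Σ` (Ex 1.1 (i)), Π_v-fixing lifts of `ρ_I = θ|_I`
  (profinite Dehn multi-twists) and their NON-DEGENERACY (the θ-form of (iv)′.2).
What is NOT in the bundle (typed clauses whose inputs are Π_I-level / log-structure statements not yet
reduced to the construction data): (ii)/(ii)′ (the image of `Π^Σ_ν`), (iv)′ (the trichotomy), the (iv) and
(viii) «Moreover» clauses, (viii)′, (x)″.  HONEST FRAMING: an assembly of the cell's kernel-proved closers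
(abc-iut-w5-d226 p435053/p441781, abc-iut-L4-t6 p425615/p443473, abc-iut-f-069 p442486–p445938); the
named inputs stay hypotheses (typed ≠ proved); nothing here bears on [IUTchIII] Cor 3.12 or takes a side.
-/

noncomputable section

open scoped Pointwise

namespace Literature.AnabelianGeometry.AbsoluteAnabelian

open Literature.AlgebraicGeometry.Frobenioids (IsSlimGroup)
open Literature.AnabelianGeometry.EtaleTheta (contMulAut mem_contMulAut TopOut)
open Literature.AnabelianGeometry.SemiGraphs
open Literature.AnabelianGeometry.Anabelioids (IsSigmaInteger)
open Topology

universe u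

namespace AbsTopII.DPSCIndexData

section OuterAction

variable {P : Type u} [Group P] [TopologicalSpace P] [IsTopologicalGroup P] [CompactSpace P]
  [TotallyDisconnectedSpace P] (G : PSCDatum P) (hG : IsTopologicallyFinitelyGenerated P)
  (hZ : Subgroup.center P = ⊥)
  {J : Type u} [Group J] [TopologicalSpace J] [IsTopologicalGroup J] [CompactSpace J]
  [TotallyDisconnectedSpace J] (θ : J →ₜ* outProfinite hG) (I : Subgroup J) [I.Normal]
  (σ : G.graph.N → ℕ) (hσ : ∀ e, IsSigmaInteger G.Sigma (σ e))

include hZ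

/-- **[AbsTopII] Prop 1.3 (i), (iii), (iii)′, (iii)″, (v), (v)′, (vi), (vii), (ix) AS TYPED, TOGETHER, at the
DPSC-extension `Π_𝒢 ⋊^out_θ J` of construction data, from hypotheses on `(G, J, θ, I)` ONLY** (see the
module docstring for the list and for what is not included). [cite: MochizukiAbsTopII2013, Prop 1.3 p.11]
[cite: MochizukiCombGC2007, Prop 1.2 p.8] -/
theorem prop13_bundle_ofOuterAction [Nontrivial P] (hslim : IsSlimGroup P)
    (hθ : ∀ j : J, ∃ φ : P ≃ₜ* P,
      TopOut.mk P ⟨φ.toMulEquiv, (mem_contMulAut P).mpr ⟨φ.continuous, φ.symm.continuous⟩⟩ =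
        outerActionOfContinuous hG θ j ∧ G.IsGraphic G φ)
    (hCT : G.VerticialEdgeLikeCommensurablyTerminal) (hDetV : G.VerticialOpenInterDeterminesVertex)
    (hDet : G.EdgeLikeOpenInterDeterminesEdge)
    (hslimv : ∀ w, IsSlimGroup ↥(G.vertGp w))
    (hnab : ∀ (e : G.graph.N), ∀ x ∈ G.nodeGp e, ∀ y ∈ G.nodeGp e, x * y = y * x)
    (hcab : ∀ (c : G.graph.C), ∀ x ∈ G.cuspGp c, ∀ y ∈ G.cuspGp c, x * y = y * x)
    (hccyc : ∀ c : G.graph.C, IsFreeProSigmaCyclic G.Sigma ↥(G.cuspGp c))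
    (hDehn : ∀ (v : G.graph.V) (i : J), i ∈ I → ∃ φ : P ≃ₜ* P,
      TopOut.mk P ⟨φ.toMulEquiv, (mem_contMulAut P).mpr ⟨φ.continuous, φ.symm.continuous⟩⟩ =
        outerActionOfContinuous hG θ i ∧ ∀ x ∈ G.vertGp v, φ x = x)
    (hND : ∀ i ∈ I, i ≠ 1 → ∀ (v v' : G.graph.V) (γ : ConjAct P),
      (∃ φ : P ≃ₜ* P,
        TopOut.mk P ⟨φ.toMulEquiv, (mem_contMulAut P).mpr ⟨φ.continuous, φ.symm.continuous⟩⟩ =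
          outerActionOfContinuous hG θ i ∧ (∀ x ∈ G.vertGp v, φ x = x) ∧ ∀ x ∈ γ • G.vertGp v', φ x = x) →
      γ • G.vertGp v' = G.vertGp v)
    (hIc : IsClosed (I : Set J)) (hI : IsFreeProSigmaCyclic G.Sigma ↥I) :
    Literature.AnabelianGeometry.AbsoluteAnabelian.AbsTopII.DPSCIndexData.Prop_1_3_i
        (ofOuterAction G hG θ I σ hσ) ∧
      (DPSCData.ofOuterAction G hG θ I).Prop13iii ∧
      Literature.AnabelianGeometry.AbsoluteAnabelian.AbsTopII.DPSCIndexData.Prop_1_3_iii'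
        (ofOuterAction G hG θ I σ hσ) ∧
      Literature.AnabelianGeometry.AbsoluteAnabelian.AbsTopII.DPSCIndexData.Prop_1_3_iii''
        (ofOuterAction G hG θ I σ hσ) ∧
      (DPSCData.ofOuterAction G hG θ I).Prop13v ∧
      Literature.AnabelianGeometry.AbsoluteAnabelian.AbsTopII.DPSCIndexData.Prop_1_3_v'
        (ofOuterAction G hG θ I σ hσ) ∧
      (DPSCData.ofOuterAction G hG θ I).Prop13vi ∧
      (DPSCData.ofOuterAction G hG θ I).Prop13vii ∧
      (DPSCData.ofOuterAction G hG θ I).Prop13ix :=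
  ⟨prop_1_3_i_ofOuterAction G hG hZ θ I σ hσ hccyc,
    DPSCData.prop13iii_ofOuterAction_of_fixing_lifts G hG hZ θ I hCT hslimv hDehn,
    prop_1_3_iii'_ofOuterAction_of_dehn G hG hZ θ I σ hσ hCT hslimv hDehn hIc hI,
    prop_1_3_iii''_ofOuterAction_of_dehn G hG hZ θ I σ hσ hCT hslimv hDehn hIc hI,
    DPSCData.prop13v_ofOuterAction_of_nondegenerate G hG hZ θ I hθ hCT hDetV hslimv hDehn hND hIc hI,
    prop_1_3_v'_ofOuterAction_of_nondegenerate G hG hZ θ I σ hσ hθ hCT hDetV hslimv hDehn hND hIc hI,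
    DPSCData.prop13vi_ofOuterAction_of_lifts G hG hZ θ I hθ hCT hDetV,
    DPSCData.prop13vii_ofOuterAction_of_dehn G hG θ I hZ hθ hCT hDet hnab hDehn,
    DPSCData.prop13ix_ofOuterAction_of_abelian G hG θ I hZ hslim hθ hCT hnab hcab⟩

end OuterAction

end AbsTopII.DPSCIndexData

end Literature.AnabelianGeometry.AbsoluteAnabelian

end
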